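import Literature.AlgebraicGeometry.Resolution.RegularBlowup
import Literature.AlgebraicGeometry.Resolution.ExceptionalDivisorRegular
import Literature.AlgebraicGeometry.Resolution.AlterationsNodalBoundary
import Literature.AlgebraicGeometry.Resolution.FormalNormalCrossingsEtale
import Literature.AlgebraicGeometry.Resolution.PrincipalizationToResolution
import Mathlib.AlgebraicGeometry.PullbackCarrier
import HarnessLib

/-!
# The exceptional divisor of the blowing up of a regular scheme along a regular centre is regular
# (Liu, Thm. 8.1.19 (b)) — hence its ideal `𝓘_Y·𝒪_{X̃}` is radical

Topic: `Literature/AlgebraicGeometry/Resolution`. PROVED over the tree. Q. Liu, *Algebraic Geometry and Arithmetic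
Curves*, OUP 2002, §8.1 Thm. 1.19 (b) (PDF p. 383 of the held copy): for the blowing-up `π : X̃ → X` of a regular
locally Noetherian scheme `X` along a regular closed subscheme `Y = V(𝓘)`, «the scheme `E := π⁻¹(Y)` is a projective
bundle `ℙ(C_{Y/X})` … over `Y`»; in particular `E` — Mathlib's closed subscheme of the inverse image ideal sheaf
`𝓘·𝒪_{X̃} = I.comap π` — is a REGULAR scheme, hence reduced, so `𝓘·𝒪_{X̃}` is a RADICAL ideal sheaf and equals the
ideal sheaf of the closed set `π⁻¹(Y)`.

The chartwise content is the tree's `ExceptionalDivisorRegular.lean`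
(`affineBlowup.isRegular_exceptional_of_isQuasiRegular`: over `D₊(x_i t)` the exceptional divisor of
`Bl_{(x)} Spec R` is the affine space `Spec (R/(x))[T_j : j ≠ i]`, for `x` quasi-regular with `R/(x)` regular).
This file globalises it EXACTLY as `RegularBlowup.lean` globalises Thm. 8.1.19 (a)
(`IsBlowup.isRegular_of_isRegular_subscheme`): any blow-up in the sense of the universal property `IsBlowup` is
isomorphic to the construction (`IsBlowup.unique`); at a point over the centre, an affine open `W = Spec A` and a basic
open `D(g)` on which the centre is cut out by a quasi-regular sequence with regular quotient
(`exists_isQuasiRegular_away_of_isRegularRing`), the restricted blow-up `π|_{D(g)}` (`IsBlowup.restrict`), and the open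
piece of `E` over `D(g)` as the fibred product `E ×_{X̃} π⁻¹D(g)` (Mathlib `Scheme.IdealSheafData.comapIso`).

* `IsBlowup.isRegular_subscheme_comap_of_isQuasiRegular` — model case over `Spec R`;
* `IsBlowup.isRegular_subscheme_comap_of_isAffine_of_isQuasiRegular` — affine base;
* `IsBlowup.isRegular_subscheme_comap` — **Liu Thm. 8.1.19 (b), regularity of `E = V(𝓘·𝒪_{X̃})`**;
* `IsBlowup.isReduced_subscheme_comap`, `IsBlowup.radical_comap_eq` — `E` reduced, `𝓘·𝒪_{X̃}` radical;
* `IsBlowup.comap_vanishingIdeal_eq_vanishingIdeal_preimage` — for the reduced ideal `𝓘_D` of a closed regular centre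
  `D`: `𝓘_D·𝒪_{X̃} = 𝓘_{π⁻¹(D)}` (the form asked for by the res-hironaka campaign, row 013, Rem. 7.9 (3) of the 2017
  manuscript: «I(D,Z)O_{Z′} = I(D′) is the ideal of the exceptional divisor D′ = π⁻¹(D)»).

## Sources
* Q. Liu, *Algebraic Geometry and Arithmetic Curves*, OUP 2002, §8.1 Thm. 1.19 (b) (PDF p. 383). [Liu2002]
-/

noncomputable section

open CategoryTheory CategoryTheory.Limits AlgebraicGeometry TopologicalSpace

namespace Literature.AlgebraicGeometry.Resolution

universe u

/-- Regularity of the closed subscheme of an ideal sheaf is invariant under pulling the ideal sheaf back along an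
isomorphism: `V(K.comap e) ≅ V(K) ×_{X} X' ≅ V(K)`. [folklore] -/
private theorem isRegular_subscheme_comap_of_isIso {X' X : Scheme.{u}} (e : X' ⟶ X) [IsIso e]
    (K : X.IdealSheafData) (hK : Scheme.IsRegular K.subscheme) : Scheme.IsRegular (K.comap e).subscheme :=
  Scheme.IsRegular.of_isOpenImmersion ((K.comapIso e).hom ≫ pullback.snd e K.subschemeι) hK

/-- **Model case.** For a quasi-regular sequence `x` in `R` with `R/(x)` regular and ANY blowing up
`π : X' → Spec R` along `(x)~` (isomorphic to `Bl_{(x)} Spec R` by `IsBlowup.unique`), the exceptional subscheme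
`V((x)·𝒪_{X'})` is regular. [cite: Liu2002, Thm. 8.1.19 (b)] -/
theorem IsBlowup.isRegular_subscheme_comap_of_isQuasiRegular {R : Type u} [CommRing R] {r : ℕ}
    (x : Fin r → R) (hx : IsQuasiRegular x) [IsRegularRing (R ⧸ Ideal.span (Set.range x))]
    {X' : Scheme.{u}} {π : X' ⟶ Spec (.of R)}
    (hπ : IsBlowup π (affineBlowup.idealSheaf (Ideal.span (Set.range x)))) :
    Scheme.IsRegular ((affineBlowup.idealSheaf (Ideal.span (Set.range x))).comap π).subscheme := by
  obtain ⟨e, he, -⟩ := hπ.unique (affineBlowup.isBlowup (Ideal.span (Set.range x)))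
  have hreg := affineBlowup.isRegular_exceptional_of_isQuasiRegular (x := x) hx
  have hK : (affineBlowup.idealSheaf (Ideal.span (Set.range x))).comap π =
      (affineBlowup.exceptionalIdeal (Ideal.span (Set.range x))).comap e.hom := by
    rw [affineBlowup.exceptionalIdeal, ← Scheme.IdealSheafData.comap_comp, he]
  rw [hK]
  exact isRegular_subscheme_comap_of_isIso e.hom _ hreg

/-- **Affine base.** If `Y` is affine and the ideal of global sections of `J` is generated by a quasi-regular
sequence `x` with `Γ(Y, 𝒪)/(x)` regular, then for every blowing up `π : X' → Y` along `J` the exceptional subscheme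
`V(J·𝒪_{X'})` is regular (transport along `Y ≅ Spec Γ(Y, 𝒪)`). [cite: Liu2002, Thm. 8.1.19 (b)] -/
theorem IsBlowup.isRegular_subscheme_comap_of_isAffine_of_isQuasiRegular {Y X' : Scheme.{u}} [IsAffine Y]
    (J : Y.IdealSheafData) {c : ℕ} (x : Fin c → Γ(Y, ⊤))
    (hJ : J.ideal ⟨⊤, isAffineOpen_top Y⟩ = Ideal.span (Set.range x)) (hx : IsQuasiRegular x)
    [IsRegularRing (Γ(Y, ⊤) ⧸ Ideal.span (Set.range x))]
    {π : X' ⟶ Y} (hπ : IsBlowup π J) : Scheme.IsRegular (J.comap π).subscheme := by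
  let e := Y.isoSpec
  have h1 : IsBlowup (π ≫ e.hom) (J.comap e.inv) := hπ.comp_iso e
  have hJ' : Scheme.IdealSheafData.ofIdealTop (J.ideal ⟨⊤, isAffineOpen_top Y⟩) = J :=
    Scheme.IdealSheafData.ext_of_isAffine (by rw [ideal_ofIdealTop_top])
  have happ : e.inv.appTop = (Scheme.ΓSpecIso Γ(Y, ⊤)).inv := by
    have h2 : e.hom.appTop ≫ e.inv.appTop = 𝟙 _ := by
      rw [← Scheme.Hom.comp_appTop, e.inv_hom_id, Scheme.Hom.id_appTop]
    rw [show e.hom = Y.toSpecΓ from rfl, Scheme.toSpecΓ_appTop] at h2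
    exact (Iso.hom_comp_eq_id _).mp h2
  have hK : J.comap e.inv = affineBlowup.idealSheaf (R := Γ(Y, ⊤)) (Ideal.span (Set.range x)) := by
    rw [← hJ', comap_ofIdealTop_of_isAffine, hJ, happ]
    rfl
  rw [hK] at h1
  have h2 := IsBlowup.isRegular_subscheme_comap_of_isQuasiRegular (R := Γ(Y, ⊤)) x hx h1
  have hK2 : (affineBlowup.idealSheaf (R := Γ(Y, ⊤)) (Ideal.span (Set.range x))).comap (π ≫ e.hom) = J.comap π := by
    rw [← hK, ← Scheme.IdealSheafData.comap_comp, Category.assoc, e.hom_inv_id, Category.comp_id]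
  rwa [hK2] at h2

/-- **Liu, Thm. 8.1.19 (b): the exceptional divisor of the blowing up of a regular locally Noetherian scheme `X`
along a regular closed subscheme `Y = V(J)` is a regular scheme** — for every morphism `π : X' → X` with the
universal property of the blowing up along `J` (`IsBlowup`), `E = V(J·𝒪_{X'})` being Mathlib's closed subscheme
`(J.comap π).subscheme`. Proof: regularity of `E` is local on `E`; a point of `E` lies over a point `x ∈ V(J)`; on an
affine open `W = Spec A ∋ x` the rings `A`, `A/J(W)` are regular, so on a basic open `D(g) ∋ x` the ideal `J` is
generated by a quasi-regular sequence with regular quotient (`exists_isQuasiRegular_away_of_isRegularRing`); the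
blowing up restricted over `D(g)` is a blowing up of `D(g)` (`IsBlowup.restrict`) whose exceptional subscheme is
regular by the affine case, and it is the open piece `E ×_{X'} π⁻¹D(g)` of `E`. [cite: Liu2002, Thm. 8.1.19 (b)] -/
theorem IsBlowup.isRegular_subscheme_comap {X' X : Scheme.{u}} {π : X' ⟶ X}
    {J : X.IdealSheafData} [IsLocallyNoetherian X] (hX : Scheme.IsRegular X)
    (hY : Scheme.IsRegular J.subscheme) (hπ : IsBlowup π J) : Scheme.IsRegular (J.comap π).subscheme := by
  refine Scheme.IsRegular.of_forall_exists_isOpenImmersion fun p => ?_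
  -- the point `x' ∈ X'` under `p ∈ E` lies over the centre
  set x' : X' := (J.comap π).subschemeι p with hx'
  have hxs : π x' ∈ J.support := by
    have h1 : x' ∈ Set.range ((J.comap π).subschemeι) := ⟨p, rfl⟩
    rw [Scheme.IdealSheafData.range_subschemeι, Scheme.IdealSheafData.support_comap] at h1
    exact h1
  -- at a point of the centre: an affine open `W ∋ π x'`
  obtain ⟨W, hW, hxW, -⟩ := exists_isAffineOpen_mem_and_subset (X := X) (x := π x') (U := ⊤)
    (Opens.mem_top _)
  haveI : IsNoetherianRing Γ(X, W) := IsLocallyNoetherian.component_noetherian ⟨W, hW⟩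
  haveI : IsRegularRing Γ(X, W) := hX.isRegularRing_of_isAffineOpen hW
  set I : Ideal Γ(X, W) := J.ideal ⟨W, hW⟩ with hI
  -- `Γ(W)/J(W)` is a regular ring: `Spec` of it is an open of the regular scheme `V(J)`
  haveI : IsRegularRing (Γ(X, W) ⧸ I) := by
    have hreg : Scheme.IsRegular (Spec (J.subschemeCover.X ⟨W, hW⟩)) :=
      Scheme.IsRegular.of_isOpenImmersion (J.subschemeCover.f ⟨W, hW⟩) hY
    exact (Scheme.isRegular_Spec_iff (.of (Γ(X, W) ⧸ I))).mp hreg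
  -- the prime `𝔭` of `π x'` and `J(W) ⊆ 𝔭`
  have hmemD : ∀ g : Γ(X, W), π x' ∈ X.basicOpen g ↔ g ∉ (hW.primeIdealOf ⟨π x', hxW⟩).asIdeal := by
    intro g
    rw [← PrimeSpectrum.mem_basicOpen, ← hW.fromSpec_preimage_basicOpen g]
    change _ ↔ hW.fromSpec (hW.primeIdealOf ⟨π x', hxW⟩) ∈ X.basicOpen g
    rw [hW.fromSpec_primeIdealOf ⟨π x', hxW⟩]
  have hIp : I ≤ (hW.primeIdealOf ⟨π x', hxW⟩).asIdeal := by
    intro f hf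
    have hz := (Scheme.IdealSheafData.mem_support_iff_of_mem (I := J) (U := ⟨W, hW⟩) hxW).mp hxs
    rw [Scheme.mem_zeroLocus_iff] at hz
    by_contra hfp
    exact hz f hf ((hmemD f).mpr hfp)
  -- the local structure theorem: a basic open `D(g) ∋ π x'` where `J` is cut out by a
  -- quasi-regular sequence with regular quotient
  obtain ⟨g, hgp, c, f, hfI, hloc⟩ := exists_isQuasiRegular_away_of_isRegularRing I _ hIp
  have hxg : π x' ∈ X.basicOpen g := (hmemD g).mpr hgp
  set V : X.Opens := X.basicOpen g with hV
  have hVaff : IsAffineOpen V := hW.basicOpen g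
  haveI : IsAffine (V : Scheme.{u}) := hVaff
  -- `Γ(V, ⊤) = Γ(X, V.ι '' ⊤)` as an `Γ(X, W)`-algebra: a localisation away from `g`
  have hle : V.ι ''ᵁ ⊤ ≤ W := by rw [Scheme.Opens.ι_image_top]; exact X.basicOpen_le g
  letI alg : Algebra Γ(X, W) Γ((V : Scheme.{u}), ⊤) :=
    (X.presheaf.map (homOfLE hle).op).hom.toAlgebra
  have halg : ∀ a : Γ(X, W), algebraMap Γ(X, W) Γ((V : Scheme.{u}), ⊤) a =
      (X.presheaf.map (homOfLE hle).op).hom a := fun a => rfl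
  haveI hlocV : IsLocalization.Away g Γ((V : Scheme.{u}), ⊤) := by
    haveI := hW.isLocalization_basicOpen g
    -- `Γ(X, D(g)) ≃ₐ Γ(D(g), ⊤)` through `V.topIso`
    refine IsLocalization.isLocalization_of_algEquiv (Submonoid.powers g)
      (AlgEquiv.ofRingEquiv (f := V.topIso.symm.commRingCatIsoToRingEquiv) fun a => ?_)
    have hcomp : X.presheaf.map (homOfLE (X.basicOpen_le g)).op ≫ V.topIso.inv =
        X.presheaf.map (homOfLE hle).op := by
      rw [Scheme.Opens.topIso_inv]
      exact ((X.presheaf.map_comp _ _).symm.trans (by rfl))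
    exact congrArg (fun φ : Γ(X, W) ⟶ Γ((V : Scheme.{u}), ⊤) => φ.hom a) hcomp
  obtain ⟨hIL, hqr, hLreg, hLq⟩ := hloc Γ((V : Scheme.{u}), ⊤)
  -- the ideal of `J|_V` on the affine scheme `V`
  have hJV : (J.comap V.ι).ideal ⟨⊤, isAffineOpen_top _⟩ =
      Ideal.span (Set.range (algebraMap Γ(X, W) Γ((V : Scheme.{u}), ⊤) ∘ f)) := by
    rw [← hIL, Scheme.IdealSheafData.ideal_comap_of_isOpenImmersion, Scheme.Opens.ι_appIso,
      Iso.refl_inv]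
    have hWV : J.ideal ⟨V.ι ''ᵁ ⊤, (isAffineOpen_top (V : Scheme.{u})).image_of_isOpenImmersion V.ι⟩ =
        I.map (X.presheaf.map (homOfLE hle).op).hom :=
      (J.map_ideal (U := ⟨V.ι ''ᵁ ⊤, _⟩) (V := ⟨W, hW⟩) hle).symm
    rw [hWV]
    change (I.map _).comap (RingHom.id _) = _
    rw [Ideal.comap_id]
    rfl
  haveI : IsRegularRing (Γ((V : Scheme.{u}), ⊤) ⧸
      Ideal.span (Set.range (algebraMap Γ(X, W) Γ((V : Scheme.{u}), ⊤) ∘ f))) := by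
    rw [← hIL]; exact hLq
  -- the exceptional subscheme of the blowing up restricted over `V` is regular …
  have hregV : Scheme.IsRegular ((J.comap V.ι).comap (π ∣_ V)).subscheme :=
    IsBlowup.isRegular_subscheme_comap_of_isAffine_of_isQuasiRegular (J.comap V.ι) _ hJV hqr (hπ.restrict V)
  -- … and it is the open piece of `E` over `V`
  have hKV : (J.comap V.ι).comap (π ∣_ V) = (J.comap π).comap (π ⁻¹ᵁ V).ι := by
    rw [← Scheme.IdealSheafData.comap_comp, ← Scheme.IdealSheafData.comap_comp, morphismRestrict_ι]
  rw [hKV] at hregV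
  refine ⟨_, ((J.comap π).comapIso (π ⁻¹ᵁ V).ι).hom ≫ pullback.snd (π ⁻¹ᵁ V).ι (J.comap π).subschemeι,
    inferInstance, ?_, hregV⟩
  -- `p` lies in that open piece since `x' ∈ π⁻¹ V`
  have hp : p ∈ Set.range (pullback.snd (π ⁻¹ᵁ V).ι (J.comap π).subschemeι) := by
    rw [Scheme.Pullback.range_snd, Set.mem_preimage, Scheme.Opens.range_ι]
    exact hxg
  obtain ⟨q, hq⟩ := hp
  refine ⟨((J.comap π).comapIso (π ⁻¹ᵁ V).ι).inv q, ?_⟩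
  have hq' : ((J.comap π).comapIso (π ⁻¹ᵁ V).ι).hom (((J.comap π).comapIso (π ⁻¹ᵁ V).ι).inv q) = q := by
    rw [← Scheme.Hom.comp_apply, Iso.inv_hom_id]
    rfl
  rw [Scheme.Hom.comp_apply, hq']
  exact hq

/-- Hence the exceptional subscheme `E = V(J·𝒪_{X'})` is reduced. [cite: Liu2002, Thm. 8.1.19 (b)] -/
theorem IsBlowup.isReduced_subscheme_comap {X' X : Scheme.{u}} {π : X' ⟶ X}
    {J : X.IdealSheafData} [IsLocallyNoetherian X] (hX : Scheme.IsRegular X)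
    (hY : Scheme.IsRegular J.subscheme) (hπ : IsBlowup π J) : IsReduced (J.comap π).subscheme :=
  (hπ.isRegular_subscheme_comap hX hY).isReduced

/-- Hence the exceptional ideal sheaf `J·𝒪_{X'}` is radical. [cite: Liu2002, Thm. 8.1.19 (b)] -/
theorem IsBlowup.radical_comap_eq {X' X : Scheme.{u}} {π : X' ⟶ X}
    {J : X.IdealSheafData} [IsLocallyNoetherian X] (hX : Scheme.IsRegular X)
    (hY : Scheme.IsRegular J.subscheme) (hπ : IsBlowup π J) : (J.comap π).radical = J.comap π := by
  haveI := hπ.isReduced_subscheme_comap hX hY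
  exact radical_eq_of_isReduced_subscheme (J.comap π)

/-- **`𝓘_D·𝒪_{X'} = 𝓘_{π⁻¹(D)}`**: for the blowing up `π` of a regular locally Noetherian scheme `X` along the
reduced ideal sheaf `𝓘_D` of a closed subset `D` whose reduced induced subscheme is regular, the inverse image
ideal sheaf `𝓘_D·𝒪_{X'}` IS the (reduced) ideal sheaf of the closed set `π⁻¹(D)` — the exceptional divisor with its
reduced structure (Hironaka 2017 Rem. 7.9 (3) p.37 «I(D,Z)O_{Z′} = I(D′) is the ideal of the exceptional divisor
D′ = π⁻¹(D)»). [cite: Liu2002, Thm. 8.1.19 (b)] -/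
theorem IsBlowup.comap_vanishingIdeal_eq_vanishingIdeal_preimage {X' X : Scheme.{u}} [IsLocallyNoetherian X]
    (hX : Scheme.IsRegular X) {π : X' ⟶ X} {D : Closeds X}
    (hD : Scheme.IsRegular (Scheme.IdealSheafData.vanishingIdeal D).subscheme)
    (hπ : IsBlowup π (Scheme.IdealSheafData.vanishingIdeal D)) :
    (Scheme.IdealSheafData.vanishingIdeal D).comap π =
      Scheme.IdealSheafData.vanishingIdeal ⟨π ⁻¹' (D : Set X), D.isClosed.preimage π.continuous⟩ := by
  have h := vanishingIdeal_preimage_eq_radical_comap π D.isClosed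
  change Scheme.IdealSheafData.vanishingIdeal _ = ((Scheme.IdealSheafData.vanishingIdeal D).comap π).radical at h
  rw [hπ.radical_comap_eq hX hD] at h
  exact h.symm

/-- The same with Mathlib's `Closeds.preimage` for the closed set `π⁻¹(D)`. [cite: Liu2002, Thm. 8.1.19 (b)] -/
theorem IsBlowup.comap_vanishingIdeal_eq_vanishingIdeal_preimage' {X' X : Scheme.{u}} [IsLocallyNoetherian X]
    (hX : Scheme.IsRegular X) {π : X' ⟶ X} {D : Closeds X}
    (hD : Scheme.IsRegular (Scheme.IdealSheafData.vanishingIdeal D).subscheme)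
    (hπ : IsBlowup π (Scheme.IdealSheafData.vanishingIdeal D)) :
    (Scheme.IdealSheafData.vanishingIdeal D).comap π =
      Scheme.IdealSheafData.vanishingIdeal (D.preimage π.continuous) :=
  hπ.comap_vanishingIdeal_eq_vanishingIdeal_preimage hX hD

end Literature.AlgebraicGeometry.Resolution

end
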